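import Literature.Barriers.RiemannHypothesis.TuranMinWitnessLoops
import HarnessLib

/-!
# Certified evaluation of `T(72 204 113 780 255)`: the cells and the main term

Barrier catalogue `Literature/Barriers/RiemannHypothesis/`, support file for the discharge of
`Literature.Barriers.RiemannHypothesis.BFM2008_thm1_minWitness`. The interval returned by each cell
evaluator of `TuranMinWitnessCalc.lean` contains the exact cell sum (scale `2^167`):

* `cellSum p i dLo dHi = ∑_{dLo<d≤dHi} (μ(d)/d) ∑_{cut i d < k ≤ cut (i+1) d} (λ(k)/k)(H(⌊y_d/k⌋) − H(m₀(d)))`;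
* `mem_cellSmall`, `mem_cellLog`, `mem_cellSieve`, `mem_cell` — `cell p i dLo dHi = some I → cellSum ∈ I`;
* `cellCheck_sound` — `cellCheck p i dLo dHi L = true → L ≤ 2^167 · cellSum`;
* `mem_mainTermEncl` — `∑_{d ≤ D} (μ(d)/d) Q(⌊N/d⌋) ∈ mainTermEncl p` (scale `2^110`).

## References

* [BorweinFergusonMossinghoff2008] P. Borwein, R. Ferguson, M. J. Mossinghoff, Math. Comp. 77
  (2008), 1681–1694, Thm. 1.
-/

open Finset ArithmeticFunction
open Literature.NumberTheory.LFunctions.LiouvilleSieve (segSieve pattern Q lamOf)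
open Literature.Analysis.ValidatedNumerics.NumericsMP

namespace Literature.Barriers.RiemannHypothesis.TuranMinWitness

attribute [local irreducible] primesList Literature.NumberTheory.LFunctions.LiouvilleSieve.pattern
  Literature.NumberTheory.LFunctions.LiouvilleSieve.segSieve

/-! ## Cell sums -/

/-- The inner sum of `d` between two cuts: `S_i(d) = ∑_{cut i d < k ≤ cut (i+1) d} f_d(k)`. [folklore] -/
noncomputable def pieceSum (p : Params) (i d : ℕ) : ℝ :=
  ∑ k ∈ Ioc (p.cut i d) (p.cut (i + 1) d), fterm (p.y d) (p.m0 d) k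

/-- The cell sum `∑_{dLo < d ≤ dHi} (μ(d)/d) S_i(d)`. [folklore] -/
noncomputable def cellSum (p : Params) (i dLo dHi : ℕ) : ℝ :=
  ∑ d ∈ Ioc dLo dHi, (moebius d : ℝ) / d * pieceSum p i d

/-- The scale `2^167` as a natural number is positive. [folklore] -/
theorem SRpos : 0 < 2 ^ SR := by positivity

/-- From an absolute error bound to interval membership at scale `2^167`. [folklore] -/
theorem mem_of_abs_le {v : ℤ} {x : ℝ} {err : ℕ} (h : |(v : ℝ) - 2 ^ SR * x| ≤ err) :
    MI.mem (2 ^ SR) x ⟨v - err, v + err⟩ := by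
  rw [abs_le] at h
  have hS : ((2 ^ SR : ℕ) : ℝ) = (2 : ℝ) ^ SR := by norm_num
  constructor
  · show ((v - err : ℤ) : ℝ) ≤ x * ((2 ^ SR : ℕ) : ℝ)
    rw [hS]; push_cast; linarith [h.1]
  · show x * ((2 ^ SR : ℕ) : ℝ) ≤ ((v + err : ℤ) : ℝ)
    rw [hS]; push_cast; linarith [h.2]

/-- One `μ(d)/d`-weighted step of an interval accumulation. [folklore] -/
theorem mem_step {x s : ℝ} {acc I : MI} {d : ℕ} (hd : 0 < d) (hacc : MI.mem (2 ^ SR) x acc)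
    (hI : MI.mem (2 ^ SR) s I) :
    MI.mem (2 ^ SR) (x + (moebius d : ℝ) / d * s) (acc.add ((I.mulInt (moebius d)).divNat d)) := by
  have h := MI.mem_divNat (MI.mem_mulInt hI (moebius d)) hd
  have e : s * ((moebius d : ℤ) : ℝ) / (d : ℕ) = (moebius d : ℝ) / d * s := by ring
  rw [e] at h
  exact MI.mem_add hacc h

/-- `H(W) < 17` from the runtime check `htab[W] + 2 ≤ 17 · 2^57`. [folklore] -/
theorem Hn_lt_17 {W : ℕ} (hW : W < 2 ^ 33) (h : ¬ (htab W)[W]! + 2 > 17 * 2 ^ SH) : Hn W < 17 := by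
  push Not at h
  have h2 := (htab_real W hW le_rfl).2
  have h3 : (((htab W)[W]! + 2 : ℕ) : ℝ) ≤ ((17 * 2 ^ SH : ℕ) : ℝ) := by exact_mod_cast h
  push_cast at h3
  have : (2 : ℝ) ^ SH * Hn W < 2 ^ SH * 17 := by linarith
  exact lt_of_mul_lt_mul_left this (by positivity)

/-! ## The small cell -/

/-- Invariant of `cellSmallLoop`. [folklore] -/
theorem cellSmallLoop_spec (p : Params) (hWQ : p.W + Q ≤ P ^ 2) (hW : p.W < 2 ^ 33)
    (hH : Hn p.W < 17) :
    ∀ (n d dHi : ℕ) (acc : MI) (x : ℝ), dHi - d = n → MI.mem (2 ^ SR) x acc →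
      MI.mem (2 ^ SR) (x + cellSum p p.nLog d dHi)
        (cellSmallLoop p (htab p.W) (lamBits (pattern Q) p.W) (tPre (lamBits (pattern Q) p.W) p.W)
          smallErr d dHi acc) := by
  intro n
  induction n with
  | zero =>
    intro d dHi acc x hn hacc
    rw [cellSmallLoop, if_neg (by omega), cellSum, Finset.Ioc_eq_empty (by omega), sum_empty, add_zero]
    exact hacc
  | succ n ih =>
    intro d dHi acc x hn hacc
    rw [cellSmallLoop, if_pos (by omega)]
    have hsplit : cellSum p p.nLog d dHi =
        (moebius (d + 1) : ℝ) / (d + 1 : ℕ) * pieceSum p p.nLog (d + 1) +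
          cellSum p p.nLog (d + 1) dHi := by
      rw [cellSum, cellSum, ← sum_Ioc_consecutive _ (Nat.le_succ d) (by omega : d + 1 ≤ dHi),
        Nat.Ioc_succ_singleton, sum_singleton]
    rw [hsplit, ← add_assoc]
    simp only
    split_ifs with hmu
    · have := ih (d + 1) dHi acc _ (by omega) hacc
      rw [hmu]; push_cast; rw [zero_div, zero_mul, add_zero]
      exact this
    · refine ih (d + 1) dHi _ _ (by omega) (mem_step (Nat.succ_pos d) hacc ?_)
      exact mem_of_abs_le (smallD_err p hWQ hW hH (Nat.succ_pos d))

/-- **The small cell encloses its sum.** [folklore] -/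
theorem mem_cellSmall (p : Params) {dLo dHi : ℕ} {I : MI} (h : cellSmall p dLo dHi = some I) :
    MI.mem (2 ^ SR) (cellSum p p.nLog dLo dHi) I := by
  unfold cellSmall at h
  simp only at h
  split_ifs at h with hc hH
  push Not at hc
  obtain ⟨hWQ, hN, hDW, hW0, hW32⟩ := hc
  simp only [Option.some.injEq] at h
  subst h
  have hW : p.W < 2 ^ 33 := lt_of_lt_of_le hW32 (by norm_num)
  have := cellSmallLoop_spec p hWQ hW (Hn_lt_17 hW hH) (dHi - dLo) dLo dHi ⟨0, 0⟩ 0 rfl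
    (by simp [MI.mem])
  rwa [zero_add] at this

/-! ## The log cells -/

/-- Invariant of `cellLogLoop`. [folklore] -/
theorem cellLogLoop_spec (p : Params) (hWQ : p.W + Q ≤ P ^ 2) (hW : p.W < 2 ^ 33)
    (hH : Hn p.W < 17) (hDW : p.D ≤ p.W) (hE0W : p.E0 ≤ p.W) (hβ : 1 ≤ p.beta) {i : ℕ}
    (hi : i < p.nLog) (hell : p.ell (i + 1) ≤ p.E0) {hl : Array ℕ}
    (hhl : hlogTab p (p.ell i) (p.ell (i + 1)) = some hl) :
    ∀ (n d : ℕ) (acc : MI) (x : ℝ), p.D - d = n → MI.mem (2 ^ SR) x acc →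
      MI.mem (2 ^ SR) (x + cellSum p i d p.D)
        (cellLogLoop p i (htab p.W) hl (lamBits (pattern Q) p.W) (logErr p.beta) d acc) := by
  intro n
  induction n with
  | zero =>
    intro d acc x hn hacc
    rw [cellLogLoop, if_neg (by omega), cellSum, Finset.Ioc_eq_empty (by omega), sum_empty, add_zero]
    exact hacc
  | succ n ih =>
    intro d acc x hn hacc
    rw [cellLogLoop, if_pos (by omega)]
    have hsplit : cellSum p i d p.D =
        (moebius (d + 1) : ℝ) / (d + 1 : ℕ) * pieceSum p i (d + 1) + cellSum p i (d + 1) p.D := by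
      rw [cellSum, cellSum, ← sum_Ioc_consecutive _ (Nat.le_succ d) (by omega : d + 1 ≤ p.D),
        Nat.Ioc_succ_singleton, sum_singleton]
    rw [hsplit, ← add_assoc]
    simp only
    split_ifs with hmu
    · have := ih (d + 1) acc _ (by omega) hacc
      rw [hmu]; push_cast; rw [zero_div, zero_mul, add_zero]
      exact this
    · refine ih (d + 1) _ _ (by omega) (mem_step (Nat.succ_pos d) hacc ?_)
      exact mem_of_abs_le (logD_err p hWQ hW hH hDW hE0W hβ hi hell hhl (Nat.succ_pos d))

/-- **The log cell encloses its sum.** [folklore] -/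
theorem mem_cellLog (p : Params) (hβ : 1 ≤ p.beta) {i : ℕ} {I : MI} (h : cellLog p i = some I) :
    MI.mem (2 ^ SR) (cellSum p i 0 p.D) I := by
  unfold cellLog at h
  simp only at h
  split_ifs at h with hc hH
  push Not at hc
  obtain ⟨hWQ, hN, hDW, hW0, hW32, hE0W, hi, hell⟩ := hc
  split at h
  · exact absurd h (by simp)
  · rename_i hl hhl
    split_ifs at h with hsz
    simp only [Option.some.injEq] at h
    subst h
    have hW : p.W < 2 ^ 33 := lt_of_lt_of_le hW32 (by norm_num)
    have := cellLogLoop_spec p hWQ hW (Hn_lt_17 hW hH) hDW hE0W hβ hi hell hhl (p.D - 0) 0 ⟨0, 0⟩ 0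
      rfl (by simp [MI.mem])
    rwa [zero_add] at this

/-! ## The sieve cells -/

/-- `kmax(d) ≤ kmax(1)` for `d ≥ 1`. [folklore] -/
theorem kmax_le_kmax_one (p : Params) {d : ℕ} (hd : 1 ≤ d) : p.kmax d ≤ p.kmax 1 := by
  unfold Params.kmax Params.y Params.m0
  rw [Nat.div_one, Nat.div_one, Nat.div_div_eq_div_mul]
  apply Nat.div_le_div_left _ (Nat.succ_pos _)
  have h1 : p.D < p.D / d * d + d := Nat.lt_div_mul_add hd
  have h2 : p.D / d * d + d = d * (p.D / d + 1) := by ring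
  omega

/-- The raw cuts beyond `nLog` do not depend on `d`. [folklore] -/
theorem rawCut_indep (p : Params) {i : ℕ} (hi : p.nLog < i) (d : ℕ) : p.rawCut i d = p.rawCut i 1 := by
  unfold Params.rawCut
  simp only [if_neg (not_le.2 hi)]

/-- The fibre of `k ↦ ⌊k/Q⌋` over `s` inside the piece `(tLo, min(kmax, tHi)]` is the run range of the
segment `s`. [folklore] -/
theorem piece_fiber {tLo tHi K s k : ℕ} :
    (k ∈ Ioc tLo (min K tHi) ∧ k / Q = s) ↔
      k ∈ Ioc (max tLo (s * Q - 1)) (min (min tHi K) (s * Q + Q - 1)) := by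
  have hQ : 0 < Q := by decide
  rw [mem_Ioc, mem_Ioc, le_min_iff, le_min_iff, le_min_iff, max_lt_iff, Nat.div_eq_iff hQ]
  constructor
  · rintro ⟨⟨h1, h2, h3⟩, h4, h5⟩
    refine ⟨⟨h1, by omega⟩, ⟨h3, h2⟩, by omega⟩
  · rintro ⟨⟨h1, h2⟩, ⟨h3, h4⟩, h5⟩
    have hk : 1 ≤ k := by omega
    refine ⟨⟨h1, h4, h3⟩, ?_, by omega⟩
    rcases Nat.eq_zero_or_pos s with hs | hs
    · subst hs; simp
    · have : 1 ≤ s * Q := Nat.one_le_iff_ne_zero.2 (Nat.mul_ne_zero (by omega) (by decide))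
      omega

/-- The piece `(min kmax tLo, min kmax tHi]` is `(tLo, min kmax tHi]` when `tLo ≤ … `; in general
`Ioc (min K tLo) (min K tHi) = Ioc tLo (min K tHi)`. [folklore] -/
theorem Ioc_min_eq {K tLo tHi : ℕ} : Ioc (min K tLo) (min K tHi) = Ioc tLo (min K tHi) := by
  ext k
  simp only [mem_Ioc, le_min_iff, min_lt_iff]
  constructor
  · rintro ⟨h1 | h1, h2, h3⟩
    · exact absurd (lt_of_lt_of_le h1 h2) (lt_irrefl _)
    · exact ⟨h1, h2, h3⟩
  · rintro ⟨h1, h2, h3⟩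
    exact ⟨Or.inr h1, h2, h3⟩

/-- **The piece sum split over the segments** `sLo ≤ s < sEnd` (`sLo·Q ≤ tLo + 1`, `tHi < sEnd·Q`). [folklore] -/
theorem pieceSum_split {F : ℕ → ℝ} {tLo tHi K sLo sEnd : ℕ} (hsLo : sLo * Q ≤ tLo + 1)
    (hsEnd : tHi < sEnd * Q) :
    ∑ k ∈ Ioc (min K tLo) (min K tHi), F k =
      ∑ s ∈ Ico sLo sEnd, ∑ k ∈ Ioc (max tLo (s * Q - 1)) (min (min tHi K) (s * Q + Q - 1)), F k := by
  have hQ : 0 < Q := by decide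
  rw [Ioc_min_eq, ← sum_fiberwise_of_maps_to (s := Ioc tLo (min K tHi)) (t := Ico sLo sEnd)
    (g := fun k => k / Q) (f := F)]
  · refine sum_congr rfl fun s _ => ?_
    congr 1
    ext k
    rw [mem_filter]
    exact piece_fiber
  · intro k hk
    obtain ⟨h1, h2⟩ := mem_Ioc.1 hk
    rw [mem_Ico]
    constructor
    · -- `sLo ≤ k/Q` from `sLo Q ≤ tLo+1 ≤ k`
      exact (Nat.le_div_iff_mul_le hQ).2 (by omega)
    · exact (Nat.div_lt_iff_lt_mul hQ).2 (by have := le_min_iff.1 h2; nlinarith [this.2])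

/-- The run sum of `d` on segment `s` (as a real). [folklore] -/
noncomputable def segPiece (p : Params) (tLo tHi s d : ℕ) : ℝ :=
  ∑ k ∈ Ioc (max tLo (s * Q - 1)) (min (min tHi (p.kmax d)) (s * Q + Q - 1)), fterm (p.y d) (p.m0 d) k

/-- Invariant of `segDLoop`: it adds `∑_{d<d'≤D} (μ(d')/d') · segPiece(s, d')`. [folklore] -/
theorem segDLoop_spec (p : Params) (hW : p.W < 2 ^ 33) (hH : Hn p.W < 17) (hE0W : p.E0 ≤ p.W)
    {s : ℕ} (hs1 : 1 ≤ s) (hsP : s * Q + Q ≤ P ^ 2) {tLo tHi : ℕ} (htLo : p.W ≤ tLo) :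
    ∀ (n d : ℕ) (acc : MI) (x : ℝ), p.D - d = n → MI.mem (2 ^ SR) x acc →
      MI.mem (2 ^ SR) (x + ∑ d' ∈ Ioc d p.D, (moebius d' : ℝ) / d' * segPiece p tLo tHi s d')
        (segDLoop p (htab p.W) (tSeg (segSieve primesList (s * Q) (pattern Q)) (s * Q)) (s * Q)
          tLo tHi d acc) := by
  have hQ : 0 < Q := by decide
  have hlo1 : 1 ≤ s * Q := Nat.one_le_iff_ne_zero.2 (Nat.mul_ne_zero (by omega) (by decide))
  have hlo : Q ∣ s * Q := Dvd.intro_left _ rfl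
  intro n
  induction n with
  | zero =>
    intro d acc x hn hacc
    rw [segDLoop, if_neg (by omega), Finset.Ioc_eq_empty (by omega), sum_empty, add_zero]
    exact hacc
  | succ n ih =>
    intro d acc x hn hacc
    rw [segDLoop, if_pos (by omega)]
    have hsplit : ∑ d' ∈ Ioc d p.D, (moebius d' : ℝ) / d' * segPiece p tLo tHi s d' =
        (moebius (d + 1) : ℝ) / (d + 1 : ℕ) * segPiece p tLo tHi s (d + 1) +
          ∑ d' ∈ Ioc (d + 1) p.D, (moebius d' : ℝ) / d' * segPiece p tLo tHi s d' := by
      rw [← sum_Ioc_consecutive _ (Nat.le_succ d) (by omega : d + 1 ≤ p.D), Nat.Ioc_succ_singleton,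
        sum_singleton]
    rw [hsplit, ← add_assoc]
    simp only
    split_ifs with hmu hBA
    · have := ih (d + 1) acc _ (by omega) hacc
      rw [hmu]; push_cast; rw [zero_div, zero_mul, add_zero]
      exact this
    · -- empty run range
      have := ih (d + 1) acc _ (by omega) hacc
      rw [segPiece, show s * Q + Q - 1 = s * Q + Q - 1 from rfl, Finset.Ioc_eq_empty (not_lt.2 hBA),
        sum_empty, mul_zero, add_zero]
      exact this
    · push Not at hBA
      refine ih (d + 1) _ _ (by omega) (mem_step (Nat.succ_pos d) hacc ?_)
      apply mem_of_abs_le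
      set A := max tLo (s * Q - 1) with hA
      set B := min (min tHi (p.kmax (d + 1))) (s * Q + Q - 1) with hB
      have key := segRuns_err p hW hH hE0W hlo (by omega) hlo1 htLo (Nat.succ_pos d)
        (tLo := tLo) (tHi := tHi) hBA
      rw [← hA, ← hB] at key
      refine key.trans ?_
      -- the allowance: `17·2^57 (B−A) + 2^111 (H B − H A) ≤ 16·((wb−wa)·2^83 + ⌊2^111 Q/max(lo,W+1)⌋ + 1)`
      set y := p.y (d + 1) with hy
      have hBy : B ≤ y := ((min_le_left _ _).trans (min_le_right _ _)).trans (kmax_le_y p (d + 1))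
      have hyB : 1 ≤ y / B := (Nat.le_div_iff_mul_le (by omega)).2 (by simpa using hBy)
      have hwb : y / B ≤ y / (A + 1) := Nat.div_le_div_left (by omega) (by omega)
      have hww : 1 ≤ y / (A + 1) - (y / B - 1) := by omega
      have hBA' : B - A ≤ Q := by omega
      have hHn : Hn B - Hn A ≤ (Q : ℝ) / max (s * Q) (p.W + 1) := by
        refine (Hn_sub_le_div hBA.le).trans ?_
        have h1 : ((B - A : ℕ) : ℝ) ≤ Q := by exact_mod_cast hBA'
        have h2 : ((max (s * Q) (p.W + 1) : ℕ) : ℝ) ≤ (A : ℝ) + 1 := by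
          have : max (s * Q) (p.W + 1) ≤ A + 1 := by
            apply max_le <;> omega
          exact_mod_cast this
        have h3 : (0 : ℝ) < ((max (s * Q) (p.W + 1) : ℕ) : ℝ) := by positivity
        calc ((B - A : ℕ) : ℝ) / (A + 1) ≤ Q / (A + 1) := by gcongr
          _ ≤ Q / ((max (s * Q) (p.W + 1) : ℕ) : ℝ) := by gcongr
      -- the integer floor
      set m := max (s * Q) (p.W + 1) with hm
      have hm0 : 0 < m := by positivity
      set F : ℕ := 2 ^ 111 * Q / m with hF
      have hfloor : (2 : ℝ) ^ 111 * ((Q : ℝ) / m) ≤ (F : ℝ) + 1 := by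
        have hmr : (0 : ℝ) < m := by exact_mod_cast hm0
        have h0 := Nat.lt_div_mul_add (a := 2 ^ 111 * Q) hm0
        have h2 : (((2 ^ 111 * Q : ℕ) : ℕ) : ℝ) < ((F * m + m : ℕ) : ℝ) := by rw [hF]; exact_mod_cast h0
        push_cast at h2
        rw [← mul_div_assoc, div_le_iff₀ hmr]
        linarith
      have p57 : (2:ℝ) ^ SH = 2 ^ 57 := by norm_num [SH]
      have p111 : (2:ℝ) ^ (ST + 1) = 2 ^ 111 := by norm_num [ST]
      rw [p57, p111]
      have hQr : (Q : ℝ) = 1058400 := by norm_num [Q]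
      have e1 : (17 : ℝ) * 2 ^ 57 * ((B - A : ℕ) : ℝ) ≤ 2 ^ 83 := by
        have h1 : ((B - A : ℕ) : ℝ) ≤ Q := by exact_mod_cast hBA'
        calc (17 : ℝ) * 2 ^ 57 * ((B - A : ℕ) : ℝ) ≤ 17 * 2 ^ 57 * Q := by
              exact mul_le_mul_of_nonneg_left h1 (by norm_num)
          _ ≤ 2 ^ 83 := by rw [hQr]; norm_num
      have e2 : (2 : ℝ) ^ 111 * (Hn B - Hn A) ≤ (F : ℝ) + 1 := by
        have := mul_le_mul_of_nonneg_left hHn (by norm_num : (0:ℝ) ≤ 2 ^ 111)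
        linarith
      have hww' : (1 : ℝ) ≤ ((y / (A + 1) - (y / B - 1) : ℕ) : ℝ) := by exact_mod_cast hww
      have hfl0 : (0 : ℝ) ≤ (F : ℝ) := by positivity
      push_cast
      linarith

/-- Invariant of `cellSieveLoop`. [folklore] -/
theorem cellSieveLoop_spec (p : Params) (hW : p.W < 2 ^ 33) (hH : Hn p.W < 17) (hE0W : p.E0 ≤ p.W)
    {tLo tHi : ℕ} (htLo : p.W ≤ tLo) {sEnd : ℕ} (hsP : sEnd * Q ≤ P ^ 2) :
    ∀ (n s : ℕ) (acc : MI) (x : ℝ), sEnd - s = n → 1 ≤ s → MI.mem (2 ^ SR) x acc →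
      MI.mem (2 ^ SR) (x + ∑ s' ∈ Ico s sEnd, ∑ d ∈ Ioc 0 p.D, (moebius d : ℝ) / d * segPiece p tLo tHi s' d)
        (cellSieveLoop p (pattern Q) (htab p.W) tLo tHi s sEnd acc) := by
  intro n
  induction n with
  | zero =>
    intro s acc x hn hs hacc
    rw [cellSieveLoop, if_neg (by omega), Finset.Ico_eq_empty (by omega), sum_empty, add_zero]
    exact hacc
  | succ n ih =>
    intro s acc x hn hs hacc
    rw [cellSieveLoop, if_pos (by omega), ← sum_Ico_consecutive _ (Nat.le_succ s) (by omega : s + 1 ≤ sEnd),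
      Nat.Ico_succ_singleton, sum_singleton, ← add_assoc]
    refine ih (s + 1) _ _ (by omega) (by omega) ?_
    have hsQ : s * Q + Q ≤ P ^ 2 := by
      have : (s + 1) * Q ≤ sEnd * Q := Nat.mul_le_mul_right Q (by omega)
      rw [add_mul, one_mul] at this
      exact this.trans hsP
    exact segDLoop_spec p hW hH hE0W hs hsQ htLo (tHi := tHi) (p.D - 0) 0 acc x rfl hacc

/-- **The sieve cell encloses its sum.** [folklore] -/
theorem mem_cellSieve (p : Params) {i : ℕ} {I : MI} (h : cellSieve p i = some I) :
    MI.mem (2 ^ SR) (cellSum p i 0 p.D) I := by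
  unfold cellSieve at h
  simp only at h
  split_ifs at h with hc hempty hP hH
  · push Not at hc
    obtain ⟨hi, htLo, hN, hDW, hW0, hW32⟩ := hc
    have hcut : ∀ d, p.cut i d = min (p.kmax d) (p.rawCut i 1) ∧
        p.cut (i + 1) d = min (p.kmax d) (p.rawCut (i + 1) 1) := fun d =>
      ⟨by rw [Params.cut, rawCut_indep p hi], by rw [Params.cut, rawCut_indep p (by omega)]⟩
    simp only [Option.some.injEq] at h
    subst h
    have hzero : cellSum p i 0 p.D = 0 := by
      apply sum_eq_zero
      intro d hd
      have hd1 : 1 ≤ d := (mem_Ioc.1 hd).1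
      rw [pieceSum, (hcut d).1, (hcut d).2, Finset.Ioc_eq_empty, sum_empty, mul_zero]
      rw [not_lt]
      rcases hempty with h1 | h1
      · exact min_le_min_left _ h1
      · have : p.kmax d ≤ p.rawCut i 1 := (kmax_le_kmax_one p hd1).trans h1
        rw [min_eq_left this]
        exact min_le_left _ _
    rw [hzero]
    simp [MI.mem]
  · push Not at hc hempty hP
    obtain ⟨hi, htLo, hN, hDW, hW0, hW32⟩ := hc
    obtain ⟨hP2, hsLo0⟩ := hP
    have hW : p.W < 2 ^ 33 := lt_of_lt_of_le hW32 (by norm_num)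
    simp only [Option.some.injEq] at h
    subst h
    have hE0W : p.E0 ≤ p.W := by
      rw [Params.E0]
      refine Nat.le_of_lt_succ ((Nat.div_lt_iff_lt_mul (Nat.succ_pos _)).2 ?_)
      rw [pow_two] at hN; exact hN
    have hcut : ∀ d, p.cut i d = min (p.kmax d) (p.rawCut i 1) ∧
        p.cut (i + 1) d = min (p.kmax d) (p.rawCut (i + 1) 1) := fun d =>
      ⟨by rw [Params.cut, rawCut_indep p hi], by rw [Params.cut, rawCut_indep p (by omega)]⟩
    set tLo := p.rawCut i 1 with htLo'
    set tHi := p.rawCut (i + 1) 1 with htHi'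
    set sLo := (tLo + 1) / Q with hsLo
    set sEnd := tHi / Q + 1 with hsEnd
    have hQ : 0 < Q := by decide
    have hsum := cellSieveLoop_spec p hW (Hn_lt_17 hW hH) hE0W htLo (tHi := tHi) hP2 (sEnd - sLo) sLo ⟨0, 0⟩ 0 rfl
      (Nat.one_le_iff_ne_zero.2 hsLo0) (by simp [MI.mem])
    rw [zero_add] at hsum
    convert hsum using 2
    rw [cellSum, sum_comm]
    refine sum_congr rfl fun d _ => ?_
    rw [← mul_sum]
    congr 1
    rw [pieceSum, (hcut d).1, (hcut d).2]
    exact pieceSum_split (Nat.div_mul_le_self _ _) (by rw [hsEnd, add_mul, one_mul]; exact Nat.lt_div_mul_add hQ)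

/-! ## All cells -/

/-- **Every cell encloses its sum** (for `β ≥ 1`). [folklore] -/
theorem mem_cell (p : Params) (hβ : 1 ≤ p.beta) {i dLo dHi : ℕ} {I : MI}
    (h : cell p i dLo dHi = some I) : MI.mem (2 ^ SR) (cellSum p i dLo dHi) I := by
  unfold cell at h
  split_ifs at h with h1 h2 h3 h4
  · obtain ⟨rfl, rfl⟩ := h2; exact mem_cellLog p hβ h
  · subst h3; exact mem_cellSmall p h
  · obtain ⟨rfl, rfl⟩ := h4; exact mem_cellSieve p h

/-- **Soundness of a cell check**: `cellCheck p i dLo dHi L = true → L ≤ 2^167 · cellSum`. [folklore] -/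
theorem cellCheck_sound (p : Params) (hβ : 1 ≤ p.beta) {i dLo dHi : ℕ} {L : ℤ}
    (h : cellCheck p i dLo dHi L = true) : (L : ℝ) ≤ cellSum p i dLo dHi * (2 ^ SR : ℕ) := by
  unfold cellCheck at h
  split at h
  · rename_i I hI
    have hm := mem_cell p hβ hI
    have hL : L ≤ I.lo := of_decide_eq_true h
    have : (L : ℝ) ≤ I.lo := by exact_mod_cast hL
    exact this.trans hm.1
  · exact absurd h (by simp)

/-! ## The main term -/

/-- `∑_{j ≤ J} ⌊2^110/j²⌋`. [folklore] -/
def qSum (J : ℕ) : ℕ := ∑ j ∈ Ioc 0 J, 2 ^ ST / (j * j)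

/-- Invariant of `qAdvance`. [folklore] -/
theorem qAdvance_spec (J : ℕ) : ∀ (fuel j : ℕ), j ≤ J → J - j ≤ fuel →
    qAdvance J fuel j (qSum j) = (J, qSum J)
  | 0, j, hj, hf => by
    have : j = J := by omega
    subst this; rfl
  | fuel + 1, j, hj, hf => by
    rw [qAdvance]
    split_ifs with h
    · have e : qSum j + 2 ^ ST / ((j + 1) * (j + 1)) = qSum (j + 1) := by
        rw [qSum, qSum, sum_Ioc_succ_top (Nat.zero_le j)]
      rw [e]
      exact qAdvance_spec J fuel (j + 1) h (by omega)
    · have : j = J := by omega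
      subst this; rfl

/-- `qSum J ≤ 2^110 Q(y) ≤ qSum J + J` for `J = ⌊√y⌋`, i.e. `⟨qSum J, qSum J + J⟩ ∋ Qn y`. [folklore] -/
theorem mem_qSum (y : ℕ) :
    MI.mem (2 ^ ST) (Qn y) ⟨(qSum (Nat.sqrt y) : ℤ), (qSum (Nat.sqrt y) : ℤ) + Nat.sqrt y⟩ := by
  set J := Nat.sqrt y
  rw [Qn]
  have key : ∀ n : ℕ, (qSum n : ℝ) ≤ (∑ j ∈ Ioc 0 n, (1 : ℝ) / j ^ 2) * (2 ^ ST : ℕ) ∧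
      (∑ j ∈ Ioc 0 n, (1 : ℝ) / j ^ 2) * (2 ^ ST : ℕ) ≤ (qSum n : ℝ) + n := by
    intro n
    induction n with
    | zero => simp [qSum]
    | succ n ih =>
      have hs : qSum (n + 1) = qSum n + 2 ^ ST / ((n + 1) * (n + 1)) := by
        rw [qSum, qSum, sum_Ioc_succ_top (Nat.zero_le n)]
      rw [hs, sum_Ioc_succ_top (Nat.zero_le n), add_mul (∑ k ∈ Ioc 0 n, (1 : ℝ) / (k : ℝ) ^ 2)]
      set q : ℕ := 2 ^ ST / ((n + 1) * (n + 1)) with hq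
      have hpos : (0 : ℝ) < ((n + 1) * (n + 1) : ℕ) := by positivity
      have hq1 : (q : ℝ) * ((n + 1) * (n + 1) : ℕ) ≤ (2 ^ ST : ℕ) := by exact_mod_cast Nat.div_mul_le_self _ _
      have hq2 : ((2 ^ ST : ℕ) : ℝ) < q * ((n + 1) * (n + 1) : ℕ) + ((n + 1) * (n + 1) : ℕ) := by
        exact_mod_cast Nat.lt_div_mul_add (by positivity)
      have e : (1 : ℝ) / ((n + 1 : ℕ) : ℝ) ^ 2 * (2 ^ ST : ℕ) = (2 ^ ST : ℕ) / ((n + 1) * (n + 1) : ℕ) := by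
        push_cast; ring
      rw [e]
      have hA : (q : ℝ) ≤ ((2 ^ ST : ℕ) : ℝ) / ((n + 1) * (n + 1) : ℕ) := by rw [le_div_iff₀ hpos]; exact hq1
      have hB : ((2 ^ ST : ℕ) : ℝ) / ((n + 1) * (n + 1) : ℕ) ≤ q + 1 := by rw [div_le_iff₀ hpos]; linarith
      push_cast at ih hA hB ⊢
      constructor <;> linarith [ih.1, ih.2]
  obtain ⟨h1, h2⟩ := key J
  constructor
  · push_cast at h1 ⊢; exact h1
  · push_cast at h2 ⊢; exact h2

/-- `⌊√y_{n+1}⌋ ≤ ⌊√y_n⌋` (the arguments increase as `d` decreases). [folklore] -/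
theorem sqrt_y_mono (p : Params) {n : ℕ} (hn : 1 ≤ n) : Nat.sqrt (p.y (n + 1)) ≤ Nat.sqrt (p.y n) := by
  apply Nat.sqrt_le_sqrt
  unfold Params.y
  exact Nat.div_le_div_left (Nat.le_succ n) hn

/-- Invariant of `mainTermLoop`: processing `n, n−1, …, 1` from `(j, qSum j)` with `j ≤ ⌊√y_n⌋`.
[folklore] -/
theorem mainTermLoop_spec (p : Params) : ∀ (n j : ℕ) (acc : MI) (x : ℝ),
    (j ≤ Nat.sqrt (p.y n) ∨ n = 0) → MI.mem (2 ^ ST) x acc →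
      MI.mem (2 ^ ST) (x + ∑ d ∈ Ioc 0 n, (moebius d : ℝ) / d * Qn (p.y d))
        (mainTermLoop p n j (qSum j) acc)
  | 0, j, acc, x, _, hacc => by simpa [mainTermLoop] using hacc
  | n + 1, j, acc, x, hj, hacc => by
    have hj' : j ≤ Nat.sqrt (p.y (n + 1)) := by
      rcases hj with h | h
      · exact h
      · omega
    rw [mainTermLoop, qAdvance_spec _ _ j hj' (by omega)]
    rw [← sum_Ioc_consecutive _ (Nat.zero_le n) (Nat.le_succ n), Nat.Ioc_succ_singleton, sum_singleton,
      show x + (∑ d ∈ Ioc 0 n, (moebius d : ℝ) / d * Qn (p.y d) +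
        (moebius (n + 1) : ℝ) / (n + 1 : ℕ) * Qn (p.y (n + 1))) =
        (x + (moebius (n + 1) : ℝ) / (n + 1 : ℕ) * Qn (p.y (n + 1))) +
          ∑ d ∈ Ioc 0 n, (moebius d : ℝ) / d * Qn (p.y d) by ring]
    have hrec : Nat.sqrt (p.y (n + 1)) ≤ Nat.sqrt (p.y n) ∨ n = 0 := by
      rcases Nat.eq_zero_or_pos n with h | h
      · exact Or.inr h
      · exact Or.inl (sqrt_y_mono p h)
    refine mainTermLoop_spec p n _ _ _ hrec ?_
    have h := MI.mem_divNat (MI.mem_mulInt (mem_qSum (p.y (n + 1))) (moebius (n + 1))) (Nat.succ_pos n)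
    have e : Qn (p.y (n + 1)) * ((moebius (n + 1) : ℤ) : ℝ) / (n + 1 : ℕ) =
        (moebius (n + 1) : ℝ) / (n + 1 : ℕ) * Qn (p.y (n + 1)) := by push_cast; ring
    rw [e] at h
    exact MI.mem_add hacc h

/-- **The main term is enclosed**: `∑_{d ≤ D} (μ(d)/d) Q(⌊N/d⌋) ∈ mainTermEncl p` (scale `2^110`).
[folklore] -/
theorem mem_mainTermEncl (p : Params) :
    MI.mem (2 ^ ST) (∑ d ∈ Ioc 0 p.D, (moebius d : ℝ) / d * Qn (p.y d)) (mainTermEncl p) := by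
  have := mainTermLoop_spec p p.D 0 ⟨0, 0⟩ 0 (Or.inl (Nat.zero_le _)) (by simp [MI.mem])
  rw [zero_add] at this
  exact this

end Literature.Barriers.RiemannHypothesis.TuranMinWitness
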